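import Literature.IUT.HodgeTheaters.ReconstructibleAlongNonFull
import Literature.IUT.HodgeTheaters.GoodLocalFrobenioidOfKit
import Literature.AlgebraicGeometry.Frobenioids.PadicFrobenioidCdashHomImage
import Literature.AlgebraicGeometry.Frobenioids.PadicFrobenioidCdashEssImage
import Literature.AlgebraicGeometry.Frobenioids.PadicFrobenioidZeroClassInvariance
import Literature.AlgebraicGeometry.Frobenioids.PadicFrobenioidLogpDivisorTransport
import HarnessLib

/-!
# [IUTchI] Example 3.3 (iii) (d) at the assembled object `GoodLocalFrobenioid.ofKit`: reduction to the two anabelian inputs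

Mochizuki, *Inter-universal Teichmüller theory I*, kurims manuscript (May 2020), Example 3.3 (iii) (d), p. 79
[claim: Mochizuki2012, status: disputed]. Print, p. 79, the lead-in sentence and then item (d), each verbatim: «Note
that it follows immediately from the category-theoreticity of the divisor monoid Φ_{C_v} [cf. [FrdI], Corollary 4.11,
(iii); [FrdII], Theorem 1.2, (i)], together with (a), (c), and the definition of C⊢_v [cf. also [AbsAnab],
Proposition 1.2.1, (v)], that» «(d) C⊢_v may be reconstructed category-theoretically from F̲_v.» [Items (a), (c) of
the same page read «(a) the subcategory D⊢_v ⊆ D_v may be reconstructed category-theoretically from D_v [cf. [AbsAnab],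
Lemma 1.3.8]» and «(c) the category D_v may be reconstructed category-theoretically from F̲_v = C_v [cf. [FrdI],
Theorem 3.4, (v); [FrdII], Theorem 1.2, (i); [FrdII], Example 1.3, (i); [AbsAnab], Lemma 1.3.1]».] Nothing of the
series is asserted; no side is taken on [IUTchIII] Cor. 3.12. The submonoid defining `C⊢_v` is that of [IUTchI]
Example 3.3 (ii), p. 78: the assignment Spec(L) ↦ ord(ℤ_{p_v}^▷) «determines an absolutely primitive [cf. [FrdII],
Example 1.1, (ii)] submonoid Φ_{C⊢_v} ⊆ Φ_{C_v}|_{D⊢_v} on D⊢_v», the term being defined in Mochizuki, *The geometry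
of Frobenioids II*, Kyushu J. Math. **62** (2008), Example 1.1 (ii), pp. 8–9
[cite: MochizukiFrdII2008, Ex 1.1 (ii) pp.8–9]: «If it holds that Φ(K) ⊆ Λ · ord(ℚ_p^×) […] for every
Spec(K) ∈ Ob(D_0), then we shall say that Φ is absolutely primitive». (Doc-only v3, referee finding N14-F3: quotes
made page-verbatim, citations of the lead-in sentence no longer folded into item (d); every declaration below is
byte-identical to v2.)

PROOF-ONLY bridge (abc-iut cell, seat abc-iut-L1-t4 gen 6; DAG node `IUTchI:Ex3.3(iii)`, row E33iii/d of
`plan/L5/SUBDAG-IUTchI-Ex33-Ex34.md`; GAP row G-w4d047g3-1 closed by p435398). abc-iut-L5-t2 typed (d) as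
`GoodLocalFrobenioid.CdashFromF G := ReconstructibleAlong G.CdashToC`; abc-iut-w4-d047's socket
`GoodLocalFrobenioid.cdashFromF_of_morphismProperty` (`ReconstructibleAlongNonFull.lean`) reduces it, for a morphism
property `P` of `C_v` cutting out the hom-image of the FAITHFUL, NON-FULL `C⊢_v ⊆ C_v`, to four inputs
`hPΦ`/`hlift`/`hobj`/`hmor`. For the object ASSEMBLED FROM THE [FrdII] KIT (`GoodLocalFrobenioid.ofKit`, every
Frobenioid-theoretic field the REAL model Frobenioid of abc-iut-L1-t4's directory) and
`P := "Div(φ) ∈ ℕ · log(p_v)"`, the inputs `hPΦ`, `hlift` and `P.RespectsIso` are layer-L1 KERNEL THEOREMS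
(`PadicFrobenioidCdashHomImage.lean`: `GoodLocalKit.div_CdashToCOver_map_mem`, `exists_CdashToCOver_map_eq`,
`respectsIso_div_mem_powers_logp_over`), and the essential image of `C⊢_v → C_v` on objects is known
(`PadicFrobenioidCdashEssImage.lean`: the objects over the image of `D⊢_v ⊆ D_v` isomorphic to `(Base, 0)`). THIS FILE
performs that discharge: `cdashFromF_ofKit_of` — clause (d) holds at `ofKit …` as soon as the two remaining inputs
hold, kept as explicit binders with their printed sources:
* `hobj` — every self-equivalence of `C_v` maps the objects of `C⊢_v` into the essential image of `C⊢_v → C_v`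
  (print: "(a), (c) above" + [FrdI] Thm. 3.4 (iii) / Cor. 4.11 (iii): Frobenius-trivial objects and the base are
  categorical; the image objects are the Frobenius-trivial objects over `D⊢_v ⊆ D_v`); `cdashFromF_ofKit_of'` takes
  it in the reduced form `hobj'`: a self-equivalence carries each `(incl A, 0)` to an object whose base lies in the
  essential image of `incl : D⊢_v → D_v` (ANABELIAN: the induced base self-equivalence preserves `D⊢_v`) and which is
  isomorphic to `(its base, 0)` (Frobenius-triviality is categorical); and `cdashFromF_ofKit_of''` discharges the
  second half by `Datum.nonempty_iso_zeroObj_map_equivalence` ([FrdI] Thm. 3.4 (iii) over an FSM-type `D_v`), leaving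
  `hDv : IsOfFSMType D_v` and the purely ANABELIAN `hbase` (the base of `e(incl A, 0)` lies in the essential image of
  `D⊢_v ⊆ D_v`);
* `hmor` — every self-equivalence of `C_v` preserves "`Div(φ) ∈ ℕ · log(p_v)`" (print: [FrdII] Thm. 1.2 (i) +
  the ramification-index rigidity of [AbsAnab] Prop. 1.2.1 (v)).
No new definition, no new Prop fact; typed ≠ proved.
-/

namespace Literature.IUT.HodgeTheaters

namespace GoodLocalFrobenioid

open CategoryTheory Opposite Literature.AlgebraicGeometry.Frobenioids Literature.AlgebraicGeometry.Frobenioids.PadicFrd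

universe u

variable {p : ℕ} [Fact p.Prime] {Dv Dd : Type u} [Category.{u} Dv] [Category.{u} Dd]
  (incl : Dd ⥤ Dv) (proj : Dv ⥤ Dd) (adj : proj ⊣ incl)
  (base : Dd ⥤ PadicFld.{u} p) (hloc : ∀ A : Dd, (base.obj A).IsPadicLocal)
  (hc : IsConnected Dd) (he : IsTotallyEpimorphic Dd) (hcV : IsConnected Dv) (heV : IsTotallyEpimorphic Dv)
  (Kv : Type) [Field Kv] [ValuativeRel Kv] (hp : ((p : Kv)) ∈ PadicFrd.intNonzero Kv) [incl.Full] [incl.Faithful]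

/-- The morphism property "`Div(φ) ∈ ℕ · log(p_v)`" of `C_v` (of the assembled `ofKit`) respects isomorphisms
(layer L1: `GoodLocalKit.respectsIso_div_mem_powers_logp_over`). [claim: Mochizuki2012, status: disputed] -/
theorem respectsIso_div_mem_powers_logp_ofKit :
    MorphismProperty.RespectsIso
      (fun X _ φ => (ModelFrobenioid.Hom.div φ).1 ∈ Submonoid.powers (primGen (proj ⋙ base) X.base) :
        MorphismProperty (ofKit incl proj adj base hloc hc he hcV heV Kv hp).Cv) :=
  GoodLocalKit.respectsIso_div_mem_powers_logp_over base proj (hlocOver proj base hloc) hcV heV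

/-- **[IUTchI] Ex. 3.3 (iii) (d) at `ofKit`, reduced to its two anabelian inputs**: with the hom-image of the
non-full `C⊢_v ⊆ C_v` cut out by "`Div(φ) ∈ ℕ · log(p_v)`" (layer L1: `GoodLocalKit.div_CdashToCOver_map_mem`,
`exists_CdashToCOver_map_eq` — `incl` is fully faithful, so the counit of `proj ⊣ incl` is an isomorphism),
`CdashFromF` (every self-equivalence of `C_v` lifts compatibly to `C⊢_v`) follows from `hobj` (self-equivalences
map objects of `C⊢_v` into its essential image) and `hmor` (self-equivalences preserve "`Div ∈ ℕ · log(p_v)`").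
[claim: Mochizuki2012, status: disputed] -/
theorem cdashFromF_ofKit_of
    (hobj : ∀ (e : (ofKit incl proj adj base hloc hc he hcV heV Kv hp).Cv ≌
        (ofKit incl proj adj base hloc hc he hcV heV Kv hp).Cv)
      (t : (ofKit incl proj adj base hloc hc he hcV heV Kv hp).Cdash),
      (ofKit incl proj adj base hloc hc he hcV heV Kv hp).CdashToC.essImage
        (e.functor.obj ((ofKit incl proj adj base hloc hc he hcV heV Kv hp).CdashToC.obj t)))
    (hmor : ∀ (e : (ofKit incl proj adj base hloc hc he hcV heV Kv hp).Cv ≌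
        (ofKit incl proj adj base hloc hc he hcV heV Kv hp).Cv)
      {X Y : (ofKit incl proj adj base hloc hc he hcV heV Kv hp).Cv} (g : X ⟶ Y),
      (ModelFrobenioid.Hom.div g).1 ∈ Submonoid.powers (primGen (proj ⋙ base) X.base) →
        (ModelFrobenioid.Hom.div (e.functor.map g)).1 ∈
          Submonoid.powers (primGen (proj ⋙ base) (e.functor.obj X).base)) :
    (ofKit incl proj adj base hloc hc he hcV heV Kv hp).CdashFromF := by
  haveI : IsIso adj.counit := inferInstance
  haveI := respectsIso_div_mem_powers_logp_ofKit incl proj adj base hloc hc he hcV heV Kv hp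
  exact cdashFromF_of_morphismProperty (ofKit incl proj adj base hloc hc he hcV heV Kv hp)
    (fun X _ φ => (ModelFrobenioid.Hom.div φ).1 ∈ Submonoid.powers (primGen (proj ⋙ base) X.base))
    (fun f => GoodLocalKit.div_CdashToCOver_map_mem base hloc hc he proj (hlocOver proj base hloc) hcV heV incl
      adj.counit f)
    (fun g hg => GoodLocalKit.exists_CdashToCOver_map_eq base hloc hc he proj (hlocOver proj base hloc) hcV heV
      incl adj.counit g hg)
    hobj hmor

/-- **[IUTchI] Ex. 3.3 (iii) (d) at `ofKit`, with `hobj` in reduced form**: it suffices that every self-equivalence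
`e` of `C_v` carries each Frobenius-trivial object `(incl A, 0)` over `D⊢_v` to an object `W` with
`Base(W)` in the essential image of `incl : D⊢_v → D_v` and `W ≅ (Base W, 0)` (layer L1:
`GoodLocalKit.CdashToCOver_essImage_iff`, `Datum.prim_nonempty_iso_zeroObj`), together with `hmor`.
[claim: Mochizuki2012, status: disputed] -/
theorem cdashFromF_ofKit_of'
    (hobj' : ∀ (e : (ofKit incl proj adj base hloc hc he hcV heV Kv hp).Cv ≌
        (ofKit incl proj adj base hloc hc he hcV heV Kv hp).Cv) (A : Dd),
      incl.essImage (e.functor.obj (ModelFrobenioid.zeroObj _ _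
          (Datum.perf (proj ⋙ base) (hlocOver proj base hloc) hcV heV).divB (incl.obj A))).base ∧
        Nonempty (e.functor.obj (ModelFrobenioid.zeroObj _ _
            (Datum.perf (proj ⋙ base) (hlocOver proj base hloc) hcV heV).divB (incl.obj A)) ≅
          ModelFrobenioid.zeroObj _ _ (Datum.perf (proj ⋙ base) (hlocOver proj base hloc) hcV heV).divB
            (e.functor.obj (ModelFrobenioid.zeroObj _ _
              (Datum.perf (proj ⋙ base) (hlocOver proj base hloc) hcV heV).divB (incl.obj A))).base))
    (hmor : ∀ (e : (ofKit incl proj adj base hloc hc he hcV heV Kv hp).Cv ≌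
        (ofKit incl proj adj base hloc hc he hcV heV Kv hp).Cv)
      {X Y : (ofKit incl proj adj base hloc hc he hcV heV Kv hp).Cv} (g : X ⟶ Y),
      (ModelFrobenioid.Hom.div g).1 ∈ Submonoid.powers (primGen (proj ⋙ base) X.base) →
        (ModelFrobenioid.Hom.div (e.functor.map g)).1 ∈
          Submonoid.powers (primGen (proj ⋙ base) (e.functor.obj X).base)) :
    (ofKit incl proj adj base hloc hc he hcV heV Kv hp).CdashFromF := by
  refine cdashFromF_ofKit_of incl proj adj base hloc hc he hcV heV Kv hp (fun e t => ?_) hmor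
  -- `C⊢→C (t) ≅ C⊢→C ((t.base, 0)) = (incl t.base, 0)`, so `e` of it is isomorphic to `e (incl t.base, 0)`
  obtain ⟨j⟩ := Datum.prim_nonempty_iso_zeroObj base hloc hc he t
  let k := (ofKit incl proj adj base hloc hc he hcV heV Kv hp).CdashToC.mapIso j ≪≫
    eqToIso (GoodLocalKit.CdashToCOver_obj_zeroObj base hloc hc he proj (hlocOver proj base hloc) hcV heV incl
      adj.counit t.base)
  obtain ⟨hb, hz⟩ := hobj' e t.base
  exact Functor.essImage.ofIso (e.functor.mapIso k).symm
    ((GoodLocalKit.CdashToCOver_essImage_iff base hloc hc he proj (hlocOver proj base hloc) hcV heV incl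
      adj.counit _).mpr ⟨hb, hz⟩)

/-- **[IUTchI] Ex. 3.3 (iii) (d) at `ofKit` over an FSM-type `D_v`, reduced to the ANABELIAN inputs**: given that
`D_v` is of FSM-type (so that [FrdI] Thm. 3.4 (iii) applies to `C_v`: self-equivalences preserve the Frobenius-trivial
objects, `Datum.nonempty_iso_zeroObj_map_equivalence`), clause (d) follows from `hbase` — every self-equivalence of
`C_v` carries `(incl A, 0)` to an object whose BASE lies in the essential image of `incl : D⊢_v → D_v` — and `hmor`.
[claim: Mochizuki2012, status: disputed] -/
theorem cdashFromF_ofKit_of'' (hDv : IsOfFSMType Dv)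
    (hbase : ∀ (e : (ofKit incl proj adj base hloc hc he hcV heV Kv hp).Cv ≌
        (ofKit incl proj adj base hloc hc he hcV heV Kv hp).Cv) (A : Dd),
      incl.essImage (e.functor.obj (ModelFrobenioid.zeroObj _ _
        (Datum.perf (proj ⋙ base) (hlocOver proj base hloc) hcV heV).divB (incl.obj A))).base)
    (hmor : ∀ (e : (ofKit incl proj adj base hloc hc he hcV heV Kv hp).Cv ≌
        (ofKit incl proj adj base hloc hc he hcV heV Kv hp).Cv)
      {X Y : (ofKit incl proj adj base hloc hc he hcV heV Kv hp).Cv} (g : X ⟶ Y),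
      (ModelFrobenioid.Hom.div g).1 ∈ Submonoid.powers (primGen (proj ⋙ base) X.base) →
        (ModelFrobenioid.Hom.div (e.functor.map g)).1 ∈
          Submonoid.powers (primGen (proj ⋙ base) (e.functor.obj X).base)) :
    (ofKit incl proj adj base hloc hc he hcV heV Kv hp).CdashFromF :=
  cdashFromF_ofKit_of' incl proj adj base hloc hc he hcV heV Kv hp
    (fun e A => ⟨hbase e A,
      (Datum.perf (proj ⋙ base) (hlocOver proj base hloc) hcV heV).nonempty_iso_zeroObj_map_equivalence hDv e _
        ⟨Iso.refl _⟩⟩)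
    hmor

/-! ### (d) at `ofKit` from BASE-LEVEL binders only (appended; abc-iut-L1-t4 «STEP-C-L1») -/

/-- **[IUTchI] Ex. 3.3 (iii) (d) at `ofKit` over a SLIM FSM-type `D_v`, from base-level inputs only**: the input
`hmor` of `cdashFromF_ofKit_of''` is discharged by the transport of `log(p_v)`-divisors
(`PadicFrd.Datum.ιHom_div_map_mem_powers_primGen`: [FrdI] Cor. 4.11 (iv) data of a self-equivalence + FULLNESS +
"`End_D` acts trivially"), leaving — besides `D_v` slim of FSM-type — the two ANABELIAN statements about the base
self-equivalences induced by self-equivalences `e` of `C_v`: `hbase` (the base of `e(incl A, 0)` lies in the essential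
image of `incl : D⊢_v → D_v`) and `hram` (for every object `X`, the value monoids `ord(O^⊳)` of the fields under
`Base X` and `Base e(X)` are isomorphic over `ord(p_v)`, i.e. `e` preserves ramification indices; print: [AbsAnab]
Prop. 1.2.1 (v)). [claim: Mochizuki2012, status: disputed] -/
theorem cdashFromF_ofKit_of''' (hDv : IsOfFSMType Dv) (hslV : IsSlim Dv)
    (hbase : ∀ (e : (ofKit incl proj adj base hloc hc he hcV heV Kv hp).Cv ≌
        (ofKit incl proj adj base hloc hc he hcV heV Kv hp).Cv) (A : Dd),
      incl.essImage (e.functor.obj (ModelFrobenioid.zeroObj _ _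
        (Datum.perf (proj ⋙ base) (hlocOver proj base hloc) hcV heV).divB (incl.obj A))).base)
    (hram : ∀ (e : (ofKit incl proj adj base hloc hc he hcV heV Kv hp).Cv ≌
        (ofKit incl proj adj base hloc hc he hcV heV Kv hp).Cv)
      (X : (ofKit incl proj adj base hloc hc he hcV heV Kv hp).Cv),
      ∃ ι : OrdInt ((proj ⋙ base).obj X.base).K ≃* OrdInt ((proj ⋙ base).obj (e.functor.obj X).base).K,
        ι (Associates.mk ⟨((p : ℕ) : ((proj ⋙ base).obj X.base).K), ((proj ⋙ base).obj X.base).p_mem⟩) =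
          Associates.mk ⟨((p : ℕ) : ((proj ⋙ base).obj (e.functor.obj X).base).K),
            ((proj ⋙ base).obj (e.functor.obj X).base).p_mem⟩) :
    (ofKit incl proj adj base hloc hc he hcV heV Kv hp).CdashFromF :=
  cdashFromF_ofKit_of'' incl proj adj base hloc hc he hcV heV Kv hp hDv hbase
    (fun e _ _ g hg => (Datum.perf (proj ⋙ base) (hlocOver proj base hloc) hcV heV).ιHom_div_map_mem_powers_primGen
      hDv hslV e (Datum.perf_exists_ιHom_eq (proj ⋙ base) (hlocOver proj base hloc) hcV heV) (hram e) g hg)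

end GoodLocalFrobenioid

end Literature.IUT.HodgeTheaters
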